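import Summits.NavierStokesRegularity.FluidComputer.BlockDegreeNoGo

/-!
# The block design — the DEGREE-CONSISTENT exchange gates: classification, and the conservative
QUADRATIC (pump-type) gate in closed form (bp3 gen 34, ASSEMBLY §2g.9(j))

HONEST FRAMING: low prior, high value-of-information experiment on Tao's machine paradigm; NOT a
claim that NS blows up. Design level only: nothing in this file is a statement about
Navier–Stokes.

`BlockDegreeNoGo` showed that the conservative gate `regGate` of `BlockRegulationGate` — the flow of
a LINEAR field of rotation type — is never the local form of a readout velocity of degree `≤ 2`
with sign-symmetric linear part. This file records what that no-go LEAVES, and inhabits it.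

* CLASSIFICATION (`QuadField.eval_eq_of_conserves`). A planar field `V` of degree `≤ 2` that
  conserves the two-block energy `W = a² + η b²` (`a V₁ + η b V₂ ≡ 0`, `QuadField.Conserves`,
  `η ≠ 0`) is EXACTLY `V (a, b) = (ω + k₁ a + k₂ b) · (−η b, a)` with `ω = (s₁)₂`, `k₁ = (q₁₁)₂`,
  `k₂ = (q₁₂)₂`; conversely every such field conserves `W` (`QuadField.lform_conserves`). If in
  addition the linear part is sign-symmetric then `ω = 0` (`QuadField.omega_eq_zero`): the
  admissible local forms are the two-parameter family `ℓ(a, b) · (−η b, a)`, `ℓ` LINEAR. (Under the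
  dictionary of `BlockDegreeNoGo` — an ASSUMPTION about NS, not checked here — the two-mode
  Galerkin truncation of ANY energy-conserving bilinear form at a clean pair state has this form,
  with `(k₁, k₂)` two wavelet coefficients.)
* THE QUADRATIC GATE (`quadGate k η`, the member `ℓ = k a`, i.e. the generator
  `quadVF k η (a, b) = (−k η a b, k a²)` — Tao's pump nonlinearity at two modes). Closed form: with
  `R = √(a² + η b²)`, `s = √η b / R`, `E = exp (k √η R σ)`, `D = (1 + s) E² + (1 − s)`,
  `quadGate k η σ (a, b) = (2 a E / D, R ((1 + s) E² − (1 − s)) / (√η D))`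
  (`a = R sech θ`, `√η b = R tanh θ`, `θ̇ = k √η R`). PROVED: it conserves `W` exactly
  (`pairEnergy_quadGate`), and for `a ≠ 0` it IS the flow of `quadVF k η`
  (`hasDerivAt_quadGate`: `∂_σ quadGate k η σ p = quadVF k η (quadGate k η σ p)` for every `σ`).
  Its generator is a `QuadField` with ZERO linear part (`quadQF`, `quadQF_eval`,
  `quadQF_conserves`, `quadQF_signSymm`): sign-symmetric and conservative, hence (by the no-go)
  uniformly far from `regField` on the open input window (`quadVF_far_regField`) — and, unlike
  `regField`, of the shape the dictionary allows.
* The companion file `BlockQuadClock` shows that `quadGate k η` inhabits the open `DatO` of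
  `BlockOpenWindow` for `Params.reg`, every `k ≥ 6`, `η ∈ [1/2, 9/10]` (transfer time
  `∝ 1/(k √η R)`: FASTER at larger amplitude, the qualitative signature of a quadratic gate), and
  assembles the circuit+clock; the residue is again the single closed Prop `OpenIdeaBound`.

HONEST READING. This converts §2g.9(i)'s pointer "a degree-consistent exchange gate must be
quadratic" into a checked object. It does NOT make the residue plausible for the bare two-wavelet
design: `OpenIdeaBound` for the quadratic clock is still presumably FALSE, now for NS-SPECIFIC
reasons only — (α) the pair's actual Galerkin form is `ℓ(a,b)·(−ηb, a)` with `(k₁, k₂)` fixed by the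
wavelets (`k₂ = 0` is one real condition on the pair, the sign of `k₁` an orientation, its SIZE a
property of the wavelets that also fixes the clock); (β) LEAKAGE — `B(u,u)` at pair states has
components outside the pair (junk, neighbouring shells) of the same order as `k`, while the
architecture tolerates a shadowing error `δsh = 1/50` per tick; making leakage small is precisely
the content of Tao's averaged construction and is absent for true NS; (γ) viscosity adds a
diagonal damping, harmless in shape (passivity survives) but it delays transfer. Nothing here is
evidence about Navier–Stokes in either direction.
-/

noncomputable section

open Set Filter Topology

namespace Summit.NavierStokesRegularity.FluidComputer

open Literature.Analysis.FluidPDE Literature.Analysis.FluidPDE.FluidComputer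

namespace BlockDesign

/-! ## Conservative planar fields of degree ≤ 2 -/

section Classification

namespace QuadField

/-- `V` CONSERVES the two-block energy `W = a² + η b²`: `a V₁(a,b) + η b V₂(a,b) = 0` identically
(`½ Ẇ` along `V`). [folklore] -/
def Conserves (V : QuadField) (η : ℝ) : Prop :=
  ∀ a b : ℝ, a * (V.eval (a, b)).1 + η * b * (V.eval (a, b)).2 = 0

variable {V : QuadField} {η : ℝ}

/-- The coefficient relations forced by conservation (`η ≠ 0`): no constant term, no `a²` in `V₁`,
no `b²`/`b` in `V₂`, and the three cross relations `(q₁₂)₁ = −η (q₁₁)₂`, `(q₂₂)₁ = −η (q₁₂)₂`,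
`(s₂)₁ = −η (s₁)₂`, `(s₁)₁ = 0`. [folklore] -/
theorem coeffs_of_conserves (hη : η ≠ 0) (h : V.Conserves η) :
    V.c.1 = 0 ∧ V.c.2 = 0 ∧ V.s1.1 = 0 ∧ V.s2.2 = 0 ∧ V.q11.1 = 0 ∧ V.q22.2 = 0 ∧
      V.q12.1 = -(η * V.q11.2) ∧ V.q22.1 = -(η * V.q12.2) ∧ V.s2.1 = -(η * V.s1.2) := by
  have h10 := h 1 0
  have hm0 := h (-1) 0
  have h20 := h 2 0
  have h01 := h 0 1
  have h0m := h 0 (-1)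
  have h02 := h 0 2
  have h11 := h 1 1
  have h1m := h 1 (-1)
  have h21 := h 2 1
  simp only [QuadField.eval] at h10 hm0 h20 h01 h0m h02 h11 h1m h21
  -- the `b`-axis relations carry a factor `η`
  have e1 : V.q22.2 + V.s2.2 + V.c.2 = 0 := by
    apply (mul_right_inj' hη).1
    linear_combination h01
  have e2 : V.q22.2 - V.s2.2 + V.c.2 = 0 := by
    apply (mul_right_inj' hη).1
    linear_combination -h0m
  have e3 : 4 * V.q22.2 + 2 * V.s2.2 + V.c.2 = 0 := by
    apply (mul_right_inj' hη).1
    linear_combination h02 / 2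
  refine ⟨?_, ?_, ?_, ?_, ?_, ?_, ?_, ?_, ?_⟩
  · linear_combination h10 - h20 / 6 - hm0 / 3
  · linear_combination e1 - e3 / 3 + e2 / 3
  · linear_combination (h10 + hm0) / 2
  · linear_combination (e1 - e2) / 2
  · linear_combination h20 / 6 - h10 / 2 - hm0 / 6
  · linear_combination e3 / 3 - e1 / 2 + e2 / 6
  · linear_combination h21 / 2 - h20 / 2 + h01 / 2 - h11 + h10
  · linear_combination (h11 + h1m - 2 * h10 - h01 - h0m) / 2
  · linear_combination (3 : ℝ) / 2 * h11 - h10 - h01 - h1m / 2 + h0m / 2 - h21 / 2 + h20 / 2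

/-- **CLASSIFICATION.** A conservative planar field of degree `≤ 2` is
`V (a, b) = (ω + k₁ a + k₂ b) · (−η b, a)` with `ω = (s₁)₂`, `k₁ = (q₁₁)₂`, `k₂ = (q₁₂)₂`:
a LINEAR form times the rotation-type field `(−η b, a)`. [folklore] -/
theorem eval_eq_of_conserves (hη : η ≠ 0) (h : V.Conserves η) (p : ℝ × ℝ) :
    V.eval p = ((V.s1.2 + V.q11.2 * p.1 + V.q12.2 * p.2) * (-(η * p.2)),
      (V.s1.2 + V.q11.2 * p.1 + V.q12.2 * p.2) * p.1) := by
  obtain ⟨hc1, hc2, hs11, hs22, hq11, hq22, hq12, hq221, hs21⟩ := coeffs_of_conserves hη h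
  simp only [QuadField.eval]
  refine Prod.ext ?_ ?_
  · linear_combination p.1 ^ 2 * hq11 + p.1 * p.2 * hq12 + p.2 ^ 2 * hq221 + p.1 * hs11 +
      p.2 * hs21 + hc1
  · linear_combination p.2 ^ 2 * hq22 + p.2 * hs22 + hc2

/-- The field `(ω + k₁ a + k₂ b) · (−η b, a)` as a `QuadField`. [folklore] -/
def lform (η ω k₁ k₂ : ℝ) : QuadField :=
  ⟨(0, k₁), (-(η * k₁), k₂), (-(η * k₂), 0), (0, ω), (-(η * ω), 0), (0, 0)⟩

/-- Evaluation of `lform`. [folklore] -/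
theorem lform_eval (η ω k₁ k₂ : ℝ) (p : ℝ × ℝ) :
    (lform η ω k₁ k₂).eval p =
      ((ω + k₁ * p.1 + k₂ * p.2) * (-(η * p.2)), (ω + k₁ * p.1 + k₂ * p.2) * p.1) := by
  simp only [QuadField.eval, lform]
  refine Prod.ext ?_ ?_ <;> ring

/-- Converse of the classification: every `lform` conserves `W`. [folklore] -/
theorem lform_conserves (η ω k₁ k₂ : ℝ) : (lform η ω k₁ k₂).Conserves η := by
  intro a b
  rw [lform_eval]
  ring

/-- A conservative field with SIGN-SYMMETRIC linear part (`BlockDegreeNoGo`) has `ω = 0`: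
`(s₁)₂ (s₂)₁ = −η ω² ≥ 0` forces `ω = 0` for `η > 0`. What survives both constraints is exactly
the family `ℓ(a,b) · (−η b, a)`, `ℓ` linear. [folklore] -/
theorem omega_eq_zero (hη : 0 < η) (h : V.Conserves η) (hs : V.SignSymm) : V.s1.2 = 0 := by
  obtain ⟨-, -, -, -, -, -, -, -, hs21⟩ := coeffs_of_conserves hη.ne' h
  unfold QuadField.SignSymm at hs
  rw [hs21] at hs
  have h1 : η * V.s1.2 ^ 2 ≤ η * 0 := by linarith [hs]
  have h2 : V.s1.2 ^ 2 ≤ 0 := le_of_mul_le_mul_left h1 hη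
  exact (pow_eq_zero_iff two_ne_zero).1 (le_antisymm h2 (sq_nonneg _))

end QuadField

end Classification

/-! ## The conservative quadratic gate in closed form -/

section Gate

/-- The PUMP-TYPE generator `(a, b) ↦ (−k η a b, k a²)` (the member `ℓ = k a`). [folklore] -/
def quadVF (k η : ℝ) (p : ℝ × ℝ) : ℝ × ℝ :=
  (-(k * η * p.1 * p.2), k * p.1 ^ 2)

/-- Amplitude radius `R = √(a² + η b²)`. [folklore] -/
def qRad (η : ℝ) (p : ℝ × ℝ) : ℝ :=
  Real.sqrt (pairEnergy η p)

/-- Loaded fraction `s = √η b / R` (`0` at the origin). [folklore] -/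
def qFrac (η : ℝ) (p : ℝ × ℝ) : ℝ :=
  Real.sqrt η * p.2 / qRad η p

/-- The conservative QUADRATIC exchange gate with coupling `k`, in closed form (see the module
docstring): `E = exp (k √η R σ)`, `D = (1 + s) E² + (1 − s)`,
`quadGate k η σ (a, b) = (2 a E / D, R ((1 + s) E² − (1 − s)) / (√η D))`. [folklore] -/
def quadGate (k η : ℝ) (σ : ℝ) (p : ℝ × ℝ) : ℝ × ℝ :=
  (2 * p.1 * Real.exp (k * Real.sqrt η * qRad η p * σ) /
      ((1 + qFrac η p) *
          (Real.exp (k * Real.sqrt η * qRad η p * σ) * Real.exp (k * Real.sqrt η * qRad η p * σ)) +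
        (1 - qFrac η p)),
    qRad η p *
        ((1 + qFrac η p) *
            (Real.exp (k * Real.sqrt η * qRad η p * σ) *
              Real.exp (k * Real.sqrt η * qRad η p * σ)) -
          (1 - qFrac η p)) /
      (Real.sqrt η *
        ((1 + qFrac η p) *
            (Real.exp (k * Real.sqrt η * qRad η p * σ) *
              Real.exp (k * Real.sqrt η * qRad η p * σ)) +
          (1 - qFrac η p))))

variable {η : ℝ}

/-- `R ≥ 0`. [folklore] -/
theorem qRad_nonneg (η : ℝ) (p : ℝ × ℝ) : 0 ≤ qRad η p :=
  Real.sqrt_nonneg _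

/-- `R² = a² + η b²` (`η ≥ 0`). [folklore] -/
theorem qRad_sq (hη : 0 ≤ η) (p : ℝ × ℝ) : qRad η p ^ 2 = p.1 ^ 2 + η * p.2 ^ 2 := by
  rw [qRad, Real.sq_sqrt (pairEnergy_nonneg hη p), pairEnergy]

/-- `|a| ≤ R`. [folklore] -/
theorem abs_le_qRad (hη : 0 ≤ η) (p : ℝ × ℝ) : |p.1| ≤ qRad η p :=
  Real.abs_le_sqrt (by rw [pairEnergy]; nlinarith [mul_nonneg hη (sq_nonneg p.2)])

/-- `|s| ≤ 1`. [folklore] -/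
theorem abs_qFrac_le_one (hη : 0 ≤ η) (p : ℝ × ℝ) : |qFrac η p| ≤ 1 := by
  unfold qFrac
  by_cases hR : qRad η p = 0
  · simp [hR]
  have hRpos : 0 < qRad η p := lt_of_le_of_ne (qRad_nonneg η p) (Ne.symm hR)
  rw [abs_div, abs_of_pos hRpos, div_le_one hRpos]
  exact Real.abs_le_sqrt (by rw [mul_pow, Real.sq_sqrt hη, pairEnergy]; nlinarith [sq_nonneg p.1])

/-- `(s R)² = η b²` (also at the origin). [folklore] -/
theorem qFrac_mul_qRad_sq (hη : 0 ≤ η) (p : ℝ × ℝ) :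
    (qFrac η p * qRad η p) ^ 2 = η * p.2 ^ 2 := by
  by_cases hR : qRad η p = 0
  · have h2 := qRad_sq hη p
    rw [hR] at h2
    have hb : η * p.2 ^ 2 = 0 := by
      nlinarith [sq_nonneg p.1, mul_nonneg hη (sq_nonneg p.2)]
    rw [hR, mul_zero, hb]
    ring
  · rw [qFrac, div_mul_cancel₀ _ hR, mul_pow, Real.sq_sqrt hη]

/-- The denominator `D = (1 + s) E² + (1 − s)` is positive. [folklore] -/
theorem qDen_pos {s E : ℝ} (hs : |s| ≤ 1) (hE : 0 < E) : 0 < (1 + s) * (E * E) + (1 - s) := by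
  obtain ⟨h1, h2⟩ := abs_le.1 hs
  rcases lt_or_ge s 1 with h | h
  · nlinarith [mul_pos hE hE]
  · have hs1 : s = 1 := le_antisymm h2 h
    subst hs1
    nlinarith [mul_pos hE hE]

/-- **The quadratic gate conserves the two-block energy exactly**, at every rescaled time and
from every state. [folklore] -/
theorem pairEnergy_quadGate (hη : 0 < η) (k σ : ℝ) (p : ℝ × ℝ) :
    pairEnergy η (quadGate k η σ p) = pairEnergy η p := by
  obtain ⟨t, ht, rfl⟩ : ∃ t : ℝ, 0 < t ∧ t ^ 2 = η :=
    ⟨Real.sqrt η, Real.sqrt_pos.2 hη, Real.sq_sqrt hη.le⟩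
  have hst : Real.sqrt (t ^ 2) = t := Real.sqrt_sq ht.le
  have hR2 := qRad_sq (sq_nonneg t) p
  have hsR2 := qFrac_mul_qRad_sq (sq_nonneg t) p
  have hs1 := abs_qFrac_le_one (sq_nonneg t) p
  simp only [pairEnergy, quadGate, hst]
  set R := qRad (t ^ 2) p
  set s := qFrac (t ^ 2) p
  set E := Real.exp (k * t * R * σ)
  have hE : 0 < E := Real.exp_pos _
  have hD : 0 < (1 + s) * (E * E) + (1 - s) := qDen_pos hs1 hE
  have hD' : (1 + s) * (E * E) + (1 - s) ≠ 0 := hD.ne'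
  have key : (2 * p.1 * E) ^ 2 + (R * ((1 + s) * (E * E) - (1 - s))) ^ 2 =
      R ^ 2 * ((1 + s) * (E * E) + (1 - s)) ^ 2 := by
    linear_combination (-4 * (E * E)) * hR2 + (4 * (E * E)) * hsR2
  rw [div_pow, div_pow, mul_pow t, ← mul_div_assoc, mul_div_mul_left _ _ (pow_ne_zero 2 ht.ne'),
    ← add_div, key, mul_div_cancel_right₀ _ (pow_ne_zero 2 hD'), ← pairEnergy]
  exact hR2

/-- **The quadratic gate is the flow of its generator**: for `a ≠ 0`,
`∂_σ quadGate k η σ p = quadVF k η (quadGate k η σ p)` at every `σ`. [folklore] -/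
theorem hasDerivAt_quadGate (hη : 0 < η) (k : ℝ) {p : ℝ × ℝ} (ha : p.1 ≠ 0) (σ : ℝ) :
    HasDerivAt (fun σ' => quadGate k η σ' p) (quadVF k η (quadGate k η σ p)) σ := by
  obtain ⟨t, ht, rfl⟩ : ∃ t : ℝ, 0 < t ∧ t ^ 2 = η :=
    ⟨Real.sqrt η, Real.sqrt_pos.2 hη, Real.sq_sqrt hη.le⟩
  have hst : Real.sqrt (t ^ 2) = t := Real.sqrt_sq ht.le
  have ht0 : t ≠ 0 := ht.ne'
  have hR2 := qRad_sq (sq_nonneg t) p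
  have hsR2 := qFrac_mul_qRad_sq (sq_nonneg t) p
  have hs1 := abs_qFrac_le_one (sq_nonneg t) p
  simp only [quadGate, quadVF, hst]
  set R := qRad (t ^ 2) p
  set s := qFrac (t ^ 2) p
  set c := k * t * R
  have ha2 : p.1 ^ 2 = R ^ 2 * (1 - s ^ 2) := by
    linear_combination (-1 : ℝ) * hR2 + hsR2
  have hDpos : ∀ σ' : ℝ, 0 < (1 + s) * (Real.exp (c * σ') * Real.exp (c * σ')) + (1 - s) :=
    fun σ' => qDen_pos hs1 (Real.exp_pos _)
  have hEd : HasDerivAt (fun σ' => Real.exp (c * σ')) (Real.exp (c * σ) * c) σ := by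
    have hl : HasDerivAt (fun σ' : ℝ => c * σ') c σ := by
      simpa using (hasDerivAt_id σ).const_mul c
    exact hl.exp
  set E := Real.exp (c * σ)
  have hE : 0 < E := Real.exp_pos _
  have hD : 0 < (1 + s) * (E * E) + (1 - s) := hDpos σ
  have hDd : HasDerivAt (fun σ' => (1 + s) * (Real.exp (c * σ') * Real.exp (c * σ')) + (1 - s))
      ((1 + s) * (E * c * E + E * (E * c))) σ :=
    ((hEd.mul hEd).const_mul (1 + s)).add_const (1 - s)
  have hNd : HasDerivAt
      (fun σ' => R * ((1 + s) * (Real.exp (c * σ') * Real.exp (c * σ')) - (1 - s)))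
      (R * ((1 + s) * (E * c * E + E * (E * c)))) σ :=
    (((hEd.mul hEd).const_mul (1 + s)).sub_const (1 - s)).const_mul R
  have h1 := (hEd.const_mul (2 * p.1)).div hDd hD.ne'
  have h2 := hNd.div (hDd.const_mul t) (mul_ne_zero ht0 hD.ne')
  refine (h1.prodMk h2).congr_deriv (Prod.ext ?_ ?_)
  · field_simp
    ring
  · have hsq : (2 * p.1 * E / ((1 + s) * (E * E) + (1 - s))) ^ 2 =
        4 * (R ^ 2 * (1 - s ^ 2)) * E ^ 2 / ((1 + s) * (E * E) + (1 - s)) ^ 2 := by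
      rw [← ha2, div_pow]
      ring
    rw [hsq]
    field_simp
    ring

/-- The generator as a `QuadField`: quadratic part `(−kη ab, k a²)`, ZERO linear part, no constant.
[folklore] -/
def quadQF (k η : ℝ) : QuadField :=
  ⟨(0, k), (-(k * η), 0), (0, 0), (0, 0), (0, 0), (0, 0)⟩

/-- `quadQF` evaluates to `quadVF`. [folklore] -/
theorem quadQF_eval (k η : ℝ) (p : ℝ × ℝ) : (quadQF k η).eval p = quadVF k η p := by
  simp only [QuadField.eval, quadQF, quadVF]
  refine Prod.ext ?_ ?_ <;> ring

/-- `quadQF` conserves `W` (it is `lform η 0 k 0` up to evaluation). [folklore] -/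
theorem quadQF_conserves (k η : ℝ) : (quadQF k η).Conserves η := by
  intro a b
  rw [quadQF_eval, quadVF]
  ring

/-- `quadQF` has sign-symmetric (indeed zero) linear part. [folklore] -/
theorem quadQF_signSymm (k η : ℝ) : (quadQF k η).SignSymm := by
  simp [QuadField.SignSymm, quadQF]

variable {S : CascadeSpecs} (P : Params S)

/-- By the no-go, the quadratic generator is uniformly FAR from the linear one on the open input
window: the two conservative gates are genuinely different local forms. [folklore] -/
theorem quadVF_far_regField (k : ℝ) (hc0 : 0 < P.c0) {ε : ℝ}
    (hε : ε < Real.pi / 2 * Real.sqrt S.eta * P.c0) :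
    ∃ p ∈ AinO P, ε < dist (quadVF k S.eta p) (regField S.eta p) := by
  obtain ⟨p, hp, h⟩ := exists_far_regField_of_AinO P (quadQF k S.eta) (quadQF_signSymm k S.eta) hc0 hε
  exact ⟨p, hp, by rwa [quadQF_eval] at h⟩

end Gate

end BlockDesign

end Summit.NavierStokesRegularity.FluidComputer
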